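import Mathlib
import HarnessLib
import Literature.Probability.RandomPlanarGeometry.HexParafermion
import Literature.Probability.RandomPlanarGeometry.HexSAW
import Summits.CriticalPhenomena.SAWScalingLimit.Theses.SAWDefectDecoherence

/-!
# Sketch (crux-ideate, ideator 3 / gen 2) — crux `DefectDecoherence` (stmt-CriticalPhenomena-8549)

First lemmas of two idea cards, stated over existing declarations (no proofs required here):

* card `cross-ratio-rigidity`: `hexShift`, `TranslationCovariance`, `cleanArrivalSum`, `sectorSum`,
  `FarFieldLipschitz` (the chirality-blind analytic input), `CrossRatioRigidityInformal` (doc only).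
* card `unit-flux-insertion`: `HermitianReversal`, `UnitBoundaryFlux`, `ReversedDefect`.
-/

noncomputable section

namespace Summit.CriticalPhenomena.SAWScalingLimit.Cruxes.DefectDecoherence.Ideator3

open Literature.Probability.RandomPlanarGeometry.SAW Literature.Probability.LatticeModels
open scoped BigOperators ComplexConjugate

/-- Lattice translation of the hexagonal lattice by a vector of the underlying triangular lattice
`Site 2 = Fin 2 → ℤ` (the face type `Fin 2` is kept): `hexCenter (hexShift τ f) = hexCenter f + triEmbed τ`. -/
def hexShift (τ : Site 2) (f : HexVertex) : HexVertex := (f.1 + τ, f.2)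

/-- FIRST LEMMA (card cross-ratio-rigidity, provable now): the parafermionic observable is covariant
under lattice translations of (domain, root, evaluation point) — weights, lengths and windings of the
transported walks are unchanged.  Consequence used by the card: for a vertex `v` and a same-colour
neighbour `v + τ`, every sector sum at `v + τ` for `(Λ, a)` equals the same sector sum at `v` for
`(Λ - τ, a - τ)`: a lattice gradient at depth `R` IS the response to a unit displacement of the far
boundary-and-root. -/
def TranslationCovariance : Prop :=
  ∀ (Λ : Finset HexVertex) (a z : Sym2 HexVertex) (x σ : ℝ) (τ : Site 2),
    hexParafermionicObservable (Λ.image (hexShift τ)) (Sym2.map (hexShift τ) a) x σ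
        (Sym2.map (hexShift τ) z) =
      hexParafermionicObservable Λ a x σ z

/-- The clean-arrival sum at vertex `v` from its neighbour `t`, twisted at frequency `ξ`:
walks `a → mid{t,v}` whose last vertex is `t` and which never visited `v`, weight
`x^{ℓ} e^{-iξ W}` (so `e^{-iξ(θ_a + W)} = e^{-iξ θ_a} ·` this, a root-direction phase). -/
def cleanArrivalSum (Λ : Finset HexVertex) (a : Sym2 HexVertex) (x ξ : ℝ) (t v : HexVertex) : ℂ :=
  ∑ γ : HexMidEdgeSAW Λ a s(t, v), if γ.verts.getLast? = some t ∧ v ∉ γ.verts then γ.weight x ξ else 0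

/-- Sector sum at `v` (sum over the three neighbours): `ξ = -3/8, 5/8, 13/8` are the sectors U, S, D
of card `sector-slaving`; `ξ = 0` is the clean-arrival MASS `M(v) > 0`. -/
def sectorSum (Λ : Finset HexVertex) (a : Sym2 HexVertex) (x ξ : ℝ) (v : HexVertex) : ℂ :=
  ∑ t ∈ Λ.filter (fun t => hexGraph.Adj v t), cleanArrivalSum Λ a x ξ t v

/-- CARD cross-ratio-rigidity — the chirality-blind analytic input (a C⁺-type statement the card's
lever is designed to prove): FAR-FIELD LIPSCHITZ STABILITY of the NORMALISED sector sums.  For an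
`R`-deep vertex `v` and a unit lattice translation `τ`, replacing `(Λ, a)` by `(Λ + τ, a + τ)` (a unit
displacement of the whole far boundary together with the root) moves every normalised sector sum
`A_ξ(v)/M(v)` by at most `C R^{-θ}`, `θ > 3/4`, uniformly in `ξ` (total-variation control of the
underlying positive law gives all frequencies at once).  By `TranslationCovariance` this is exactly
lattice-Lipschitz regularity of `A_ξ/M` between same-colour neighbours at depth `R`. -/
def FarFieldLipschitz : Prop :=
  ∃ C θ : ℝ, 3 / 4 < θ ∧ ∀ (Λ : Finset HexVertex), hexDomainSimplyConnected Λ →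
    ∀ (u w : HexVertex), hexGraph.Adj u w → u ∉ Λ → w ∈ Λ →
    ∀ (v : HexVertex) (R : ℝ), 1 ≤ R →
      (∀ y : HexVertex, dist (hexCenter y) (hexCenter v) ≤ R → y ∈ Λ) →
    ∀ (τ : Site 2), ‖triEmbed τ‖ = 1 → ∀ ξ : ℝ,
      ‖sectorSum Λ s(u, w) hexCriticalFugacity ξ v / sectorSum Λ s(u, w) hexCriticalFugacity 0 v -
          sectorSum (Λ.image (hexShift τ)) s(hexShift τ u, hexShift τ w) hexCriticalFugacity ξ v /
            sectorSum (Λ.image (hexShift τ)) s(hexShift τ u, hexShift τ w) hexCriticalFugacity 0 v‖ ≤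
        C * R ^ (-θ)

/-- FIRST LEMMA (card unit-flux-insertion, provable now from `pturn_reverse`-type facts):
HERMITIAN REVERSAL.  Reversing a walk preserves its length and negates its winding, so for real
`x, σ` the observable is Hermitian in (root, target): `F(z → a) = conj F(a → z)` whenever both are
mid-edges of the domain.  With DCS Lemma 1 this gives `ReversedDefect` below. -/
def HermitianReversal : Prop :=
  ∀ (Λ : Finset HexVertex) (a z : Sym2 HexVertex) (x σ : ℝ),
    a ∈ hexDomainMidEdges Λ → z ∈ hexDomainMidEdges Λ →
      hexParafermionicObservable Λ z x σ a = conj (hexParafermionicObservable Λ a x σ z)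

/-- SECOND LEMMA (card unit-flux-insertion; the HV-model instance is `HV.boundary_sum` in
`HexSAWObservable.lean`, provable now by transport): UNIT BOUNDARY FLUX.  For every simply connected
domain and boundary root `a`, summing the vertex relation over all vertices and using that the exit
direction of a walk at a boundary mid-edge is its initial direction turned by `W`:
`Σ_{z ∈ ∂Ω ∖ {a}} F_{x_c, -3/8}(a → z) = 1` — i.e. `Σ_{γ : a → ∂Ω∖a} e^{+i(3/8)W(γ)} x_c^{ℓ(γ)} = 1`
(Elvey Price–de Gier–Guttmann–Lee 2012, Lemma 3 at `n = 0`, `x = x_c`: `H_Ω(x_c) = C_Ω = 1`).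
The card INSERTS this identity in the slit domain `Λ ∖ γ₀` at the tip of every clean prefix `γ₀`. -/
def UnitBoundaryFlux : Prop :=
  ∀ (Λ : Finset HexVertex), hexDomainSimplyConnected Λ → ∀ a ∈ hexDomainBoundary Λ,
    ∑ᶠ z ∈ hexDomainBoundary Λ \ {a}, hexParafermionicObservable Λ a hexCriticalFugacity (-3 / 8) z = 1

/-- THE CRUX READ BACKWARDS (card unit-flux-insertion, from `HermitianReversal`): the conjugated
star defect at `v` for root `a` equals the DCS vertex combination AT `v` of the observables ROOTED at
the three mid-edges of `v` and EVALUATED at the boundary mid-edge `a` (root and target exchanged):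
`conj T(v; a) = Σ_{t ∼ v} (mid{v,t} - c_v) · F_{x_c,5/8}(Λ; s(v,t) → a)`, so the crux says that the
vertex relation survives the exchange of root and target up to `C R^{-θ} ×` mass. -/
def ReversedDefect : Prop :=
  ∀ (Λ : Finset HexVertex) (u w v : HexVertex), hexGraph.Adj u w → u ∉ Λ → w ∈ Λ → v ∈ Λ →
    (∀ t, hexGraph.Adj v t → t ∈ Λ) →
    conj (∑ t ∈ Λ.filter (fun t => hexGraph.Adj v t),
        conj (hexMidpoint s(v, t) - hexCenter v) *
          hexParafermionicObservable Λ s(u, w) hexCriticalFugacity (5 / 8) s(v, t)) =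
      ∑ t ∈ Λ.filter (fun t => hexGraph.Adj v t),
        (hexMidpoint s(v, t) - hexCenter v) *
          hexParafermionicObservable Λ s(v, t) hexCriticalFugacity (5 / 8) s(u, w)

/-- Sanity: the reversal identity turns the crux into a bound on the root/target-exchanged vertex
combination (pure rewriting; recorded to show the two forms have the same type of conclusion). -/
theorem reversedDefect_norm_eq (hR : ReversedDefect) (Λ : Finset HexVertex) (u w v : HexVertex)
    (huw : hexGraph.Adj u w) (hu : u ∉ Λ) (hw : w ∈ Λ) (hv : v ∈ Λ)
    (hn : ∀ t, hexGraph.Adj v t → t ∈ Λ) :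
    ‖∑ t ∈ Λ.filter (fun t => hexGraph.Adj v t),
        conj (hexMidpoint s(v, t) - hexCenter v) *
          hexParafermionicObservable Λ s(u, w) hexCriticalFugacity (5 / 8) s(v, t)‖ =
      ‖∑ t ∈ Λ.filter (fun t => hexGraph.Adj v t),
        (hexMidpoint s(v, t) - hexCenter v) *
          hexParafermionicObservable Λ s(v, t) hexCriticalFugacity (5 / 8) s(u, w)‖ := by
  rw [← hR Λ u w v huw hu hw hv hn, Complex.norm_conj]

end Summit.CriticalPhenomena.SAWScalingLimit.Cruxes.DefectDecoherence.Ideator3
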